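import Summits.ABC.IUTFork.Repair.CandInternal2RealStrata
import Summits.ABC.IUTFork.Repair.CandInternal2NoGoHeight
import Summits.ABC.IUTFork.Cor312LicenceShallowConcreteDatum
import Summits.ABC.IUTFork.Cor312LicenceShallowConcreteDatumQuad
import Summits.ABC.IUTFork.Cor312LicenceShallowConcreteDatumSqrtNegOne
import Summits.ABC.IUTFork.ForkGenuineRatInputs
import HarnessLib

/-!
# IUT REPAIR branch → R-H (D-0079 «LOCAL-HEIGHT CONDITION I06⋆», rung LADDER-ABC:A2.RESCUE.H) — `RHI06StarConcreteRows`: the I06⋆ cells of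
# the CONCRETE rows of `plan/rescue/R-H/I06STAR-COLUMNS.tsv` (block (3): S-X75, S-X75i, S-X72, S-RAT) DECIDED IN KERNEL at the row, and
# the calibration «tame real cell = this lineage's height bed `shellHSetting p m_q (e_w − 1)`»

PROOF-ONLY file (D-0012: 0 definitions, 0 `Prop` facts) of the abc-iut cell; seat abc-iut-w5-d133 gen 6 (WAKE director-abc W12 14:30:16Z;
abc-iut-rh-lead's RE-ARM row 14:28:05Z «ProfileHeight* beds → I06STAR-COLUMNS rows w5d180:/concrete: (cells POS/NEG by name)»). TAKES NO SIDE
on [IUTchIII] Cor. 3.12 or on any author. Nothing is restated: the DECIDING LEMMAS are abc-iut-rp-d2's `CandInternal2RealLabels` (p450037: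
`mem_pow_smul_logShell_iff_of_le`, `norm_eq_rpow_of_pow_eq`), `CandInternal2RealStrata` (p451037/p451708: `mem_pow_smul_logShell_of_height_lt_sharp`)
and `CandInternal2Real` (p432650: `not_mem_jsq_smul_logShell_of_unramified`); the DATA are abc-iut-w6-d114's `ConcreteDatum.X75` (`ℚ(⁵√7)`, p441984),
`ConcreteDatumSqrtNegOne.X75i` (`ℚ(⁵√7, √−1)`), `ConcreteDatumQuad.X72` (`ℚ(√7)`, abc-iut-w5-d180's multi-slot realising datum p442550) and «any
`PilotData` over `ℚ`» (abc-iut-w5-d204 `Cor312LicenceSharpRat`); the HEIGHT BED is this lineage's `ProfileHeight.shellHSetting` read through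
abc-iut-rp-d2's `CandInternal2NoGoHeight.star_H_iff`. This file only INSTANTIATES them AT THE ROW, with the row's local parameters
`(p, e_w, H, l)` READ OFF THE DATUM DECLARATION BY NAME (`X75_l`, `X75_lstar`, `X75_ordq`, `ConcreteDatum.ramIdx_of_mem_placesOver`, …), so that the
table's «certified» column can cite a kernel name (START-HERE v1 §2: «certified = deciding_decl instantiates at the row»).

THE CELL (START-HERE v1 §1, interim writer abc-iut-rp-d2's UNITS of record): at a bad place `w | p` of the datum and a label `j ∈ 𝔽_l^⋇`, for the
REAL log-shell `𝓘_{K_w} = (p*)⁻¹·log_p(𝒪^×_{K_w})` ([AbsTopIII] Def. 5.4 (iii)) of a complete ultrametric field `K_w/ℚ_p` carrying the datum's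
absolute ramification index `e_w`, and the Kummer datum `q̲_w` = a `2l`-th ROOT of the Tate parameter ([IUTchII] Introduction p. 2 l. 48–50), i.e.
ANY `q̲ ∈ K_w` with `‖q̲‖^{2l} = ‖q_v‖ = p^{−ord_v(q_v)/e_v}`: «`q̲ ∈ q̲^{j²}·𝓘_{K_w}`».

RESULTS (numbers, not adjectives; every `K` below: `NontriviallyNormedField`, `NormedAlgebra ℚ_[p]`, `IsUltrametricDist`, `ProperSpace`).
§1 ROW RECIPES (data-independent): `mem_one_smul_logShell` — the label `j = 1` cell holds for EVERY `q ≠ 0` at EVERY place (sharp edge, `n = 1`);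
`mem_pow_smul_logShell_iff_of_le_root` — TAME CLOSED FORM in root units: `p > 2`, `e ≤ p − 2`, `‖q̲‖^N = p^{−H}` ⟹ (`q̲ ∈ q̲^n·𝓘 ⟺ (n−1)·H ≤ N·(1 − 1/e)`);
`mem_pow_smul_logShell_iff_int` — the same in the table's INTEGER slack form `(n−1)·H·e ≤ N·(e − 1)` (i.e. `(j²−1)·m_q ≤ d_w = e_w − 1`, `m_q = e_w·H/(2l)`).
§2 S-X75 (`ℚ(⁵√7)`, `p = 7`, `e_w = 5`, `ord_v(q_v) = 10`, `l = 5`; local class `‖q̲‖^{10} = 7^{−2}`): `x75_cell_iff : q̲ ∈ q̲^n·𝓘 ⟺ n ≤ 5`; cells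
`x75_j1_pos`, **`x75_j2_pos`** (`3/5 ≤ 4/5`), `x75_j3_not_mem` (first failing label `j = 3 ∉ 𝔽_5^⋇`); datum verdict **`x75_row_pos`**: for every
`v ∈ X75.S`, every `K_w/ℚ_7` with `absRamificationIdx 7 K_w = ramIdx F75 v` and every `q̲ ≠ 0` with `‖q̲‖^{2·X75.l} = 7^{−ord_v(q_v)/e_v}`, ALL labels
`i : Fin X75.lstar` hold — I06⋆-cell POS at every cell of the datum.
§3 S-X75i (`ℚ(⁵√7, √−1)`, `e_w = 5`, `f_w = 2`): same local class (`f_w` does not enter) — **`x75i_row_pos`**.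
§4 S-X72 (`ℚ(√7)`, `e_w = 2`, `ord_v(q_v) = 10`, `l = 5`; class `‖q̲‖^{10} = 7^{−5}`): `x72_cell_iff : q̲ ∈ q̲^n·𝓘 ⟺ n ≤ 2`; `x72_j1_pos`, **`x72_j2_not_mem`**
(`3/2 > 1/2`); datum verdict **`x72_row_neg`** (the top label `i = 1` of `Fin X72.lstar` fails) — the k4 SEPARATING row of START-HERE §1: on this datum the
(xi-f) licence / `S_H` is kernel-INHABITED (abc-iut-w5-d180 p442550, abc-iut-w6-d114 `…QuadLicence`) while the I06⋆ cell fails.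
§5 S-RAT (any `PilotData X` over `ℚ`, any bad place `v ∈ X.S` of ODD residue characteristic `p`; `e_v = 1` by abc-iut-skel's
`GenuineContent.ramIdx_rat_eq_one`): **`rat_row_neg`** — for every `K_w/ℚ_p` with `absRamificationIdx p K_w = ramIdx ℚ v`, every `q̲ ≠ 0` with `‖q̲‖ < 1`
and every label `j ≥ 2`: `q̲ ∉ q̲^{j²}·𝓘` (rp-d2's unramified-odd NEG, instantiated).
§6 CALIBRATION «ProfileHeight bed → rows»: **`tameCell_iff_heightBed`** — for `p > 2`, `e ≤ p − 2`, `‖q̲‖ = p^{−m/e}` (`m = ord_w(q̲) ≥ 1`), the binding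
(`j = 2`) real cell `q̲ ∈ q̲⁴·𝓘_{K_w}` holds IFF abc-iut-rp-d2's `HQShellOrbitStar` holds on this lineage's HEIGHT BED `shellHSetting p m (e − 1)` (both are
`3m ≤ e − 1`: `star_H_iff`); instances `heightBed_x75_pos` (`(7, 1, 4)`: `3 ≤ 4`) and `heightBed_x72_neg` (`(7, 1, 1)`: `3 > 1`) — the toy H-column of
record and the real column AGREE on the tame stratum with `(h, d) = (m_q, e_w − 1)`.

HONEST SCOPE. PilotData / local-class level ONLY: «`K_w` = any complete ultrametric field over `ℚ_7` with the datum's `e`» stands in for the completion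
(the tree has no completion functor for these number fields); whether GENUINE initial Θ-data realise these synthetic data is NOT claimed (R-W: `ℚ(⁵√7) ⊆ ℝ`
is excluded as `F` of a Θ-datum by [IUTchI] Def. 3.1 (a); at K-level genuine data `e_w ≥ l`). A decided cell is a statement about OUR typed real
log-shell; typed ≠ proved; instantiated ≠ endorsed; refuted-as-typed ≠ refuted-in-print; nothing here asserts abc. [claim: Mochizuki2012, status: disputed]
for the quoted readings; [cite: MochizukiAbsTopIII2015, Def 5.4 (iii) p. 126]; [cite: DupuyHilado2025, §3.3]. Axioms: standard.
-/

noncomputable section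

namespace Summit.ABC.IUTFork.Repair.RHI06StarConcreteRows

open Set Metric NumberField IsDedekindDomain
open scoped Pointwise
open Literature.AnabelianGeometry.AbsoluteAnabelian Literature.IUT.LogThetaLattice Literature.IUT.LogVolume
  Summit.ABC.IUTFork.Repair.CandInternal2Real Summit.ABC.IUTFork.Repair.CandInternal2RealLabels
  Summit.ABC.IUTFork.Repair.CandInternal2RealStrata

/-! ## §1. Row recipes (data-independent) -/

section Recipes

variable (p : ℕ) [Fact p.Prime]
variable (K : Type*) [NontriviallyNormedField K] [NormedAlgebra ℚ_[p] K] [IsUltrametricDist K] [ProperSpace K]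

/-- **LABEL `j = 1`: the cell holds for every `q ≠ 0`, every `p`, every ramification** (`q ∈ q¹·𝓘_K ⟺ 1 ∈ 𝓘_K`; abc-iut-rp-d2's sharp edge
`mem_pow_smul_logShell_of_height_lt_sharp` at `n = 1`: `0 < c − 1/(p−1)`). The `@p.j1` rows of every datum. [cite: MochizukiAbsTopIII2015, Def 5.4 (iii) p. 126] -/
theorem mem_one_smul_logShell {q : K} (hq : q ≠ 0) : q ∈ q ^ (1 ^ 2) • logShell (PadicLogOnUnits.ofUnitLog p K) := by
  have hp1 : (1 : ℝ) < p := by exact_mod_cast (Fact.out : p.Prime).one_lt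
  have hp0 : (0 : ℝ) < p := by linarith
  have hqpos : 0 < ‖q‖ := norm_pos_iff.2 hq
  -- `‖q‖ = p^{−h}` with `h := −log‖q‖/log p`
  have hqh : ‖q‖ = (p : ℝ) ^ (-(-(Real.log ‖q‖) / Real.log p)) := by
    rw [neg_div, neg_neg, Real.rpow_def_of_pos hp0, mul_div_cancel₀ _ (Real.log_pos hp1).ne', Real.exp_log hqpos]
  refine mem_pow_smul_logShell_of_height_lt_sharp p K hq hqh ?_
  have hc : 1 / ((p : ℝ) - 1) < ((if p = 2 then 2 else 1 : ℕ) : ℝ) := by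
    by_cases h2 : p = 2
    · subst h2; rw [if_pos rfl]; norm_num
    · rw [if_neg h2]
      have h3 : (3 : ℝ) ≤ p := by
        have := (Fact.out : p.Prime).two_le
        exact_mod_cast (show 3 ≤ p by omega)
      rw [div_lt_iff₀ (by linarith)]
      push_cast
      linarith
  have hone : ((1 ^ 2 : ℕ) : ℝ) = 1 := by norm_num
  rw [hone, sub_self, zero_mul]
  linarith

/-- **TAME CLOSED FORM in root units**: `p > 2`, `e ≤ p − 2`, `‖q̲‖^N = p^{−H}` (`N > 0`) ⟹ (`q̲ ∈ q̲^n·𝓘_K ⟺ (n−1)·H ≤ N·(1 − 1/e)`) — abc-iut-rp-d2's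
`mem_pow_smul_logShell_iff_of_le` with `h = H/N` (`norm_eq_rpow_of_pow_eq`). For `N = 2l`, `H = ord_p(q_E)`, `n = j²` this is the table's
«slack_j ≥ 0» EXACTLY (both signs) on the tame stratum. [cite: MochizukiAbsTopIII2015, Def 5.4 (iii) p. 126] [claim: Mochizuki2012, status: disputed] -/
theorem mem_pow_smul_logShell_iff_of_le_root (hp : 2 < p) (he : absRamificationIdx p K ≤ p - 2) {q : K} (hq : q ≠ 0) {N : ℕ}
    (hN : 0 < N) {H : ℝ} (hqN : ‖q‖ ^ N = (p : ℝ) ^ (-H)) (n : ℕ) :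
    q ∈ q ^ n • logShell (PadicLogOnUnits.ofUnitLog p K) ↔ ((n : ℝ) - 1) * H ≤ N * (1 - 1 / (absRamificationIdx p K : ℝ)) := by
  rw [mem_pow_smul_logShell_iff_of_le p K hp he hq (norm_eq_rpow_of_pow_eq p (Nat.pos_iff_ne_zero.1 hN) hqN) n]
  have hN' : (0 : ℝ) < N := by exact_mod_cast hN
  rw [← mul_div_assoc, div_le_iff₀ hN']
  constructor <;> intro h <;> linarith

/-- **TAME CLOSED FORM, INTEGER SLACK** (the table's columns): `p > 2`, `e ≤ p − 2`, `‖q̲‖^N = p^{−H}` ⟹ (`q̲ ∈ q̲^n·𝓘_K ⟺ (n−1)·H·e ≤ N·(e − 1)`),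
i.e. with `m_q := e·H/N` (`= ord_w(q̲)`) and `d_w := e − 1`: «`(j²−1)·m_q ≤ d_w`». [cite: MochizukiAbsTopIII2015, Def 5.4 (iii) p. 126] [claim: Mochizuki2012, status: disputed] -/
theorem mem_pow_smul_logShell_iff_int (hp : 2 < p) (he : absRamificationIdx p K ≤ p - 2) {q : K} (hq : q ≠ 0) {N : ℕ}
    (hN : 0 < N) {H : ℝ} (hqN : ‖q‖ ^ N = (p : ℝ) ^ (-H)) (n : ℕ) :
    q ∈ q ^ n • logShell (PadicLogOnUnits.ofUnitLog p K) ↔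
      ((n : ℝ) - 1) * H * (absRamificationIdx p K : ℝ) ≤ N * ((absRamificationIdx p K : ℝ) - 1) := by
  rw [mem_pow_smul_logShell_iff_of_le_root p K hp he hq hN hqN n]
  have he0 : (0 : ℝ) < (absRamificationIdx p K : ℝ) := by exact_mod_cast absRamificationIdx_pos p K
  have hrew : (N : ℝ) * (1 - 1 / (absRamificationIdx p K : ℝ)) =
      N * ((absRamificationIdx p K : ℝ) - 1) / (absRamificationIdx p K : ℝ) := by
    field_simp
  rw [hrew, le_div_iff₀ he0]

end Recipes

/-! ## §2. Row S-X75: `concrete:Cor312LicenceShallowConcreteDatum.X75` (`ℚ(⁵√7)`, `p = 7`, `e_w = 5`, `ord_v(q_v) = 10`, `l = 5`) -/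

section X75

open Summit.ABC.IUTFork.ConcreteDatum

variable (K : Type*) [NontriviallyNormedField K] [NormedAlgebra ℚ_[7] K] [IsUltrametricDist K] [ProperSpace K]

/-- **LOCAL CLASS OF S-X75 / S-X75i (`p = 7`, `e = 5`, `‖q̲‖^{10} = 7^{−2}`): `q̲ ∈ q̲^n·𝓘 ⟺ n ≤ 5`** (tame closed form: `(n−1)·2 ≤ 10·(1 − 1/5) = 8`).
Labels `j = 1, 2` (`n = 1, 4`) POS; the first failing label is `j = 3` (`n = 9`), outside `𝔽_5^⋇`. [claim: Mochizuki2012, status: disputed] -/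
theorem x75_cell_iff (he : absRamificationIdx 7 K = 5) {q : K} (hq : q ≠ 0) (hqN : ‖q‖ ^ 10 = (7 : ℝ) ^ (-(2 : ℝ))) (n : ℕ) :
    q ∈ q ^ n • logShell (PadicLogOnUnits.ofUnitLog 7 K) ↔ n ≤ 5 := by
  have hqN' : ‖q‖ ^ 10 = ((7 : ℕ) : ℝ) ^ (-(2 : ℝ)) := by rw [hqN]; norm_num
  rw [mem_pow_smul_logShell_iff_of_le_root 7 K (by norm_num) (by rw [he]) hq (by norm_num : 0 < 10) hqN' n, he]
  push_cast
  constructor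
  · intro h
    have h5 : (n : ℝ) ≤ 5 := by linarith
    exact_mod_cast h5
  · intro h
    have h5 : (n : ℝ) ≤ 5 := by exact_mod_cast h
    linarith

/-- Row `S-X75@p7.j1` (and `S-X75i@p7.j1`): POS. [claim: Mochizuki2012, status: disputed] -/
theorem x75_j1_pos (he : absRamificationIdx 7 K = 5) {q : K} (hq : q ≠ 0) (hqN : ‖q‖ ^ 10 = (7 : ℝ) ^ (-(2 : ℝ))) :
    q ∈ q ^ (1 ^ 2) • logShell (PadicLogOnUnits.ofUnitLog 7 K) :=
  (x75_cell_iff K he hq hqN _).2 (by norm_num)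

/-- **Row `S-X75@p7.j2` (and `S-X75i@p7.j2`), the binding cell: POS** (`h = 3/5 ≤ κ = 4/5`). [claim: Mochizuki2012, status: disputed] -/
theorem x75_j2_pos (he : absRamificationIdx 7 K = 5) {q : K} (hq : q ≠ 0) (hqN : ‖q‖ ^ 10 = (7 : ℝ) ^ (-(2 : ℝ))) :
    q ∈ q ^ (2 ^ 2) • logShell (PadicLogOnUnits.ofUnitLog 7 K) :=
  (x75_cell_iff K he hq hqN _).2 (by norm_num)

/-- The label profile of the class: `j = 3` (`n = 9 > 5`) would FAIL — `j_pos_upto = 2`; irrelevant to I06⋆ at `l = 5` (`l⋇ = 2`), recorded for the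
`label_profile` column. [claim: Mochizuki2012, status: disputed] -/
theorem x75_j3_not_mem (he : absRamificationIdx 7 K = 5) {q : K} (hq : q ≠ 0) (hqN : ‖q‖ ^ 10 = (7 : ℝ) ^ (-(2 : ℝ))) :
    q ∉ q ^ (3 ^ 2) • logShell (PadicLogOnUnits.ofUnitLog 7 K) := fun h => by
  have := (x75_cell_iff K he hq hqN _).1 h
  norm_num at this

/-- All labels of `𝔽_5^⋇` (`j ≤ 2`) are POS for the class. [claim: Mochizuki2012, status: disputed] -/
theorem x75_allLabels_pos (he : absRamificationIdx 7 K = 5) {q : K} (hq : q ≠ 0) (hqN : ‖q‖ ^ 10 = (7 : ℝ) ^ (-(2 : ℝ))) :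
    ∀ j ≤ 2, q ∈ q ^ (j ^ 2) • logShell (PadicLogOnUnits.ofUnitLog 7 K) := fun j hj =>
  (x75_cell_iff K he hq hqN _).2 (by nlinarith)

/-- **DATUM VERDICT S-X75: I06⋆-cell POS at EVERY cell of `X75`** — for every bad place `v ∈ X75.S` (all `v | 7` of `ℚ(⁵√7)`: `p_v = 7`,
`e_v = 5` by abc-iut-w6-d114's `ramIdx_of_mem_placesOver`, `ord_v(q_v) = 10` by `X75_ordq`, `l = 5`, `l⋇ = 2`), every complete ultrametric `K_w/ℚ_7`
with the datum's absolute ramification index, every `q̲ ≠ 0` with `‖q̲‖^{2l} = 7^{−ord_v(q_v)/e_v}` (a `2l`-th root of `q_v` in norm) and every label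
`i+1`, `i : Fin X75.lstar`: `q̲ ∈ q̲^{(i+1)²}·𝓘_{K_w}`. [claim: Mochizuki2012, status: disputed] [cite: DupuyHilado2025, §3.3] -/
theorem x75_row_pos {v : HeightOneSpectrum (𝓞 ↥F75)} (hv : v ∈ X75.S) (he : absRamificationIdx 7 K = ramIdx ↥F75 v) {q : K}
    (hq : q ≠ 0) (hqN : ‖q‖ ^ (2 * X75.l) = (7 : ℝ) ^ (-((X75.ordq v : ℝ) / (ramIdx ↥F75 v : ℝ)))) :
    ∀ i : Fin X75.lstar, q ∈ q ^ (((i : ℕ) + 1) ^ 2) • logShell (PadicLogOnUnits.ofUnitLog 7 K) := by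
  rw [ramIdx_of_mem_placesOver hv] at he hqN
  rw [X75_ordq hv, X75_l] at hqN
  have hqN' : ‖q‖ ^ 10 = (7 : ℝ) ^ (-(2 : ℝ)) := by
    rw [show (10 : ℕ) = 2 * 5 by norm_num, hqN]; norm_num
  intro i
  have hi : ((i : ℕ) + 1) ≤ 2 := by have h2 : X75.lstar = 2 := X75_lstar; have := i.isLt; omega
  exact x75_allLabels_pos K he hq hqN' _ hi

end X75

/-! ## §3. Row S-X75i: `concrete:Cor312LicenceShallowConcreteDatumSqrtNegOne.X75i` (`ℚ(⁵√7, √−1)`, `e_w = 5`, `f_w = 2`) — same local class -/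

section X75i

open Summit.ABC.IUTFork.ConcreteDatumSqrtNegOne

variable (K : Type*) [NontriviallyNormedField K] [NormedAlgebra ℚ_[7] K] [IsUltrametricDist K] [ProperSpace K]

/-- **DATUM VERDICT S-X75i: I06⋆-cell POS at EVERY cell of `X75i`** (`e_v = 5` by abc-iut-w6-d114's `ConcreteDatumSqrtNegOne.ramIdx_of_mem_placesOver`,
`ord_v(q_v) = 10`, `l = 5`; the residue degree `f_v = 2` does not enter the cell). [claim: Mochizuki2012, status: disputed] [cite: DupuyHilado2025, §3.3] -/
theorem x75i_row_pos {v : HeightOneSpectrum (𝓞 ↥F75i)} (hv : v ∈ X75i.S) (he : absRamificationIdx 7 K = ramIdx ↥F75i v) {q : K}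
    (hq : q ≠ 0) (hqN : ‖q‖ ^ (2 * X75i.l) = (7 : ℝ) ^ (-((X75i.ordq v : ℝ) / (ramIdx ↥F75i v : ℝ)))) :
    ∀ i : Fin X75i.lstar, q ∈ q ^ (((i : ℕ) + 1) ^ 2) • logShell (PadicLogOnUnits.ofUnitLog 7 K) := by
  rw [ramIdx_of_mem_placesOver hv] at he hqN
  rw [X75i_ordq hv, X75i_l] at hqN
  have hqN' : ‖q‖ ^ 10 = (7 : ℝ) ^ (-(2 : ℝ)) := by
    rw [show (10 : ℕ) = 2 * 5 by norm_num, hqN]; norm_num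
  intro i
  have hi : ((i : ℕ) + 1) ≤ 2 := by have h2 : X75i.lstar = 2 := X75i_lstar; have := i.isLt; omega
  exact x75_allLabels_pos K he hq hqN' _ hi

end X75i

/-! ## §4. Row S-X72: `concrete:Cor312LicenceShallowConcreteDatumQuad.X72` (`ℚ(√7)`, `p = 7`, `e_w = 2`, `ord_v(q_v) = 10`, `l = 5`) -/

section X72

open Summit.ABC.IUTFork.ConcreteDatumQuad Summit.ABC.IUTFork.RamifiedMover

variable (K : Type*) [NontriviallyNormedField K] [NormedAlgebra ℚ_[7] K] [IsUltrametricDist K] [ProperSpace K]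

/-- **LOCAL CLASS OF S-X72 (`p = 7`, `e = 2`, `‖q̲‖^{10} = 7^{−5}`): `q̲ ∈ q̲^n·𝓘 ⟺ n ≤ 2`** (`(n−1)·5 ≤ 10·(1 − 1/2) = 5`). Label `j = 1` POS, label
`j = 2` (`n = 4`) NEG. [claim: Mochizuki2012, status: disputed] -/
theorem x72_cell_iff (he : absRamificationIdx 7 K = 2) {q : K} (hq : q ≠ 0) (hqN : ‖q‖ ^ 10 = (7 : ℝ) ^ (-(5 : ℝ))) (n : ℕ) :
    q ∈ q ^ n • logShell (PadicLogOnUnits.ofUnitLog 7 K) ↔ n ≤ 2 := by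
  have hqN' : ‖q‖ ^ 10 = ((7 : ℕ) : ℝ) ^ (-(5 : ℝ)) := by rw [hqN]; norm_num
  rw [mem_pow_smul_logShell_iff_of_le_root 7 K (by norm_num) (by rw [he]; norm_num) hq (by norm_num : 0 < 10) hqN' n, he]
  push_cast
  constructor
  · intro h
    have h2 : (n : ℝ) ≤ 2 := by linarith
    exact_mod_cast h2
  · intro h
    have h2 : (n : ℝ) ≤ 2 := by exact_mod_cast h
    linarith

/-- Row `S-X72@p7.j1`: POS. [claim: Mochizuki2012, status: disputed] -/
theorem x72_j1_pos (he : absRamificationIdx 7 K = 2) {q : K} (hq : q ≠ 0) (hqN : ‖q‖ ^ 10 = (7 : ℝ) ^ (-(5 : ℝ))) :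
    q ∈ q ^ (1 ^ 2) • logShell (PadicLogOnUnits.ofUnitLog 7 K) :=
  (x72_cell_iff K he hq hqN _).2 (by norm_num)

/-- **Row `S-X72@p7.j2`, the binding cell: NEG** (`h = 3/2 > κ = 1/2`; slack `−1`). [claim: Mochizuki2012, status: disputed] -/
theorem x72_j2_not_mem (he : absRamificationIdx 7 K = 2) {q : K} (hq : q ≠ 0) (hqN : ‖q‖ ^ 10 = (7 : ℝ) ^ (-(5 : ℝ))) :
    q ∉ q ^ (2 ^ 2) • logShell (PadicLogOnUnits.ofUnitLog 7 K) := fun h => by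
  have := (x72_cell_iff K he hq hqN _).1 h
  norm_num at this

/-- **DATUM VERDICT S-X72: I06⋆-cell NEG** — at the (single) bad place `v₇` of `X72` (`e = 2` by `ConcreteDatumQuad.ramIdx_v7`, `ord_v(q_v) = 10` by
`X72_ordq`, `l = 5`), for every `K_w/ℚ_7` with the datum's ramification index and every `q̲ ≠ 0` with `‖q̲‖^{2l} = 7^{−ord_v(q_v)/e_v}`, NOT every label
of `𝔽_5^⋇` holds: the top label `i = 1` (`j = 2`) fails. The SEPARATING row of START-HERE §1 (k4): here the (xi-f) licence / `S_H` is kernel-inhabited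
(abc-iut-w5-d180 `Cor312LicenceShallowMultiSlotF7`, abc-iut-w6-d114 `…ConcreteDatumQuadLicence`) while the I06⋆ cell fails. [claim: Mochizuki2012, status: disputed] -/
theorem x72_row_neg {v : HeightOneSpectrum (𝓞 ↥F7)} (hv : v ∈ X72.S) (he : absRamificationIdx 7 K = ramIdx ↥F7 v) {q : K}
    (hq : q ≠ 0) (hqN : ‖q‖ ^ (2 * X72.l) = (7 : ℝ) ^ (-((X72.ordq v : ℝ) / (ramIdx ↥F7 v : ℝ)))) :
    ¬ ∀ i : Fin X72.lstar, q ∈ q ^ (((i : ℕ) + 1) ^ 2) • logShell (PadicLogOnUnits.ofUnitLog 7 K) := by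
  have hv7 := eq_v7_of_mem_X72_S v hv
  subst hv7
  rw [ramIdx_v7] at he hqN
  rw [X72_ordq hv, X72_l] at hqN
  have hqN' : ‖q‖ ^ 10 = (7 : ℝ) ^ (-(5 : ℝ)) := by
    rw [show (10 : ℕ) = 2 * 5 by norm_num, hqN]; norm_num
  intro h
  have h2 := h ⟨1, by rw [X72_lstar]; norm_num⟩
  exact x72_j2_not_mem K he hq hqN' h2

/-- … while its label-`1` cell (`i = 0`) holds (cells `1:0:1`). [claim: Mochizuki2012, status: disputed] -/
theorem x72_row_j1_pos {v : HeightOneSpectrum (𝓞 ↥F7)} (hv : v ∈ X72.S) (he : absRamificationIdx 7 K = ramIdx ↥F7 v) {q : K}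
    (hq : q ≠ 0) (hqN : ‖q‖ ^ (2 * X72.l) = (7 : ℝ) ^ (-((X72.ordq v : ℝ) / (ramIdx ↥F7 v : ℝ)))) :
    q ∈ q ^ ((0 + 1) ^ 2) • logShell (PadicLogOnUnits.ofUnitLog 7 K) := by
  have hv7 := eq_v7_of_mem_X72_S v hv
  subst hv7
  rw [ramIdx_v7] at he hqN
  rw [X72_ordq hv, X72_l] at hqN
  have hqN' : ‖q‖ ^ 10 = (7 : ℝ) ^ (-(5 : ℝ)) := by
    rw [show (10 : ℕ) = 2 * 5 by norm_num, hqN]; norm_num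
  exact x72_j1_pos K he hq hqN'

end X72

/-! ## §5. Row S-RAT: `concrete:Cor312LicenceSharpRat` (any `PilotData` over `ℚ`; `e_v = f_v = 1` at every place) -/

section Rat

open Summit.ABC.IUTFork.GenuineContent (ramIdx_rat_eq_one)

variable (p : ℕ) [Fact p.Prime]
variable (K : Type*) [NontriviallyNormedField K] [NormedAlgebra ℚ_[p] K] [IsUltrametricDist K] [ProperSpace K]

/-- **DATUM VERDICT S-RAT: NEG at every label `j ≥ 2`** — for every pilot datum `X` over `ℚ` (abc-iut-w5-d204's `Cor312LicenceSharpRat` class),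
every bad place `v ∈ X.S` lying over an ODD prime `p`, every `K_w/ℚ_p` with the datum's ramification index (`= 1`, abc-iut-skel's
`GenuineContent.ramIdx_rat_eq_one`: the unram-odd stratum) and EVERY `q̲ ≠ 0` of norm `< 1` (in particular any root of the Tate parameter):
`q̲ ∉ q̲^{j²}·𝓘_{K_w}` — abc-iut-rp-d2's `not_mem_jsq_smul_logShell_of_unramified` instantiated at the row (`𝓘 = 𝒪` there). Row `S-RAT@p7.j2` is the
representative `p = 7`. [cite: MochizukiAbsTopIII2015, Def 5.4 (iii) p. 126] -/
theorem rat_row_neg (X : PilotData ℚ) {v : HeightOneSpectrum (𝓞 ℚ)} (_hv : v ∈ X.S) (hp : p ≠ 2)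
    (he : absRamificationIdx p K = ramIdx ℚ v) {q : K} (hq : q ≠ 0) (hq1 : ‖q‖ < 1) {j : ℕ} (hj : 2 ≤ j) :
    q ∉ q ^ (j ^ 2) • logShell (PadicLogOnUnits.ofUnitLog p K) := by
  rw [ramIdx_rat_eq_one] at he
  exact not_mem_jsq_smul_logShell_of_unramified p K hp he hq hq1 hj

/-- Row `S-RAT@p.j1`: POS (as every `j = 1` cell). [cite: MochizukiAbsTopIII2015, Def 5.4 (iii) p. 126] -/
theorem rat_row_j1_pos {q : K} (hq : q ≠ 0) : q ∈ q ^ (1 ^ 2) • logShell (PadicLogOnUnits.ofUnitLog p K) :=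
  mem_one_smul_logShell p K hq

/-- The S-RAT datum verdict in the `Fin l⋇` indexing: for a root `q̲` of norm `< 1`, NOT all labels of `𝔽_l^⋇` hold (the label `j = 2`, i.e. `i = 1 < l⋇`
since `l⋇ ≥ 2`, fails). [cite: MochizukiAbsTopIII2015, Def 5.4 (iii) p. 126] -/
theorem rat_row_not_allLabels (X : PilotData ℚ) {v : HeightOneSpectrum (𝓞 ℚ)} (hv : v ∈ X.S) (hp : p ≠ 2)
    (he : absRamificationIdx p K = ramIdx ℚ v) {q : K} (hq : q ≠ 0) (hq1 : ‖q‖ < 1) :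
    ¬ ∀ i : Fin X.lstar, q ∈ q ^ (((i : ℕ) + 1) ^ 2) • logShell (PadicLogOnUnits.ofUnitLog p K) := fun h =>
  rat_row_neg p K X hv hp he hq hq1 (le_refl 2) (h ⟨1, X.two_le_lstar⟩)

end Rat

/-! ## §6. Calibration: on the tame stratum the real binding cell IS this lineage's HEIGHT BED `shellHSetting p m_q (e_w − 1)` -/

section HeightBed

open Thm311 Cor312 Cor312Vol Cor312.Checks Cor312.IdentifiedNonVacuity Cor312Vol.NaiveWitness Cor312Vol.PinnedWitness Cor312Vol.PinnedHonest
  Summit.ABC.IUTFork.Repair.ProfileHeight Summit.ABC.IUTFork.Repair.CandInternal11Gap Summit.ABC.IUTFork.Repair.CandInternal2NoGoHeight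

variable (p : ℕ) [hp : Fact p.Prime]
variable (K : Type*) [NontriviallyNormedField K] [NormedAlgebra ℚ_[p] K] [IsUltrametricDist K] [ProperSpace K]

/-- **TAME REAL CELL = HEIGHT-BED CELL.** For `p > 2`, `e ≤ p − 2` and `q̲ ≠ 0` with `‖q̲‖ = p^{−m/e}` (`m = ord_w(q̲) ≥ 1`, the table's `m_q`), the binding
real cell `q̲ ∈ q̲^{2²}·𝓘_{K_w}` holds IFF abc-iut-rp-d2's `HQShellOrbitStar` holds on abc-iut-w5-d133's height bed at `(p, h, d) = (p, m, e − 1)` — both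
say `3·m ≤ e − 1` (`mem_pow_smul_logShell_iff_of_le` / `CandInternal2NoGoHeight.star_H_iff`). The toy H-column and the real column agree on the tame
stratum. [claim: Mochizuki2012, status: disputed] -/
theorem tameCell_iff_heightBed (hp2 : 2 < p) (he : absRamificationIdx p K ≤ p - 2) {q : K} (hq : q ≠ 0) {m : ℕ} (hm : 0 < m)
    (hqm : ‖q‖ = (p : ℝ) ^ (-((m : ℝ) / (absRamificationIdx p K : ℝ)))) :
    q ∈ q ^ (2 ^ 2) • logShell (PadicLogOnUnits.ofUnitLog p K) ↔
      HQShellOrbitStar (naiveFullH p m).toLatticeSituation (shellHSetting p m (absRamificationIdx p K - 1))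
        (rhoShellH p m (absRamificationIdx p K - 1)) (qDatumH p m) := by
  rw [star_H_iff p m _ hm, mem_pow_smul_logShell_iff_of_le p K hp2 he hq hqm (2 ^ 2)]
  have he1 := absRamificationIdx_pos p K
  have he0 : (0 : ℝ) < (absRamificationIdx p K : ℝ) := by exact_mod_cast he1
  have hcast : (((absRamificationIdx p K - 1 : ℕ)) : ℝ) = (absRamificationIdx p K : ℝ) - 1 := by
    rw [Nat.cast_sub he1]; simp
  have hlhs : (((2 ^ 2 : ℕ) : ℝ) - 1) * ((m : ℝ) / (absRamificationIdx p K : ℝ)) =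
      3 * (m : ℝ) / (absRamificationIdx p K : ℝ) := by push_cast; ring
  have hrhs : (1 - 1 / (absRamificationIdx p K : ℝ)) * (absRamificationIdx p K : ℝ) = (absRamificationIdx p K : ℝ) - 1 := by
    field_simp
  rw [hlhs, div_le_iff₀ he0, hrhs, ← hcast]
  constructor
  · intro h
    exact_mod_cast h
  · intro h
    exact_mod_cast h

/-- **Instance S-X75 / S-X75i on the height bed** (`p = 7`, `m_q = 1`, `d = e_w − 1 = 4`): the bed's I06⋆ holds (`3 ≤ 4`). [claim: Mochizuki2012, status: disputed] -/
theorem heightBed_x75_pos :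
    HQShellOrbitStar (naiveFullH 7 1).toLatticeSituation (shellHSetting 7 1 4) (rhoShellH 7 1 4) (qDatumH 7 1) :=
  haveI : Fact (Nat.Prime 7) := ⟨by norm_num⟩
  (star_H_iff 7 1 4 Nat.one_pos).2 (by norm_num)

/-- **Instance S-X72 on the height bed** (`p = 7`, `m_q = 1`, `d = e_w − 1 = 1`): the bed's I06⋆ FAILS (`3 > 1`). [claim: Mochizuki2012, status: disputed] -/
theorem heightBed_x72_neg :
    ¬ HQShellOrbitStar (naiveFullH 7 1).toLatticeSituation (shellHSetting 7 1 1) (rhoShellH 7 1 1) (qDatumH 7 1) := fun h => by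
  haveI : Fact (Nat.Prime 7) := ⟨by norm_num⟩
  have := (star_H_iff 7 1 1 Nat.one_pos).1 h
  omega

/-- **The S-X75 class read on the height bed through the calibration**: with `e = 5` and `‖q̲‖ = 7^{−1/5}` (`m_q = 1`) the real binding cell holds, AS the
bed `(7, 1, 4)` says. [claim: Mochizuki2012, status: disputed] -/
theorem x75_j2_pos_via_heightBed (K₇ : Type*) [NontriviallyNormedField K₇] [NormedAlgebra ℚ_[7] K₇] [IsUltrametricDist K₇] [ProperSpace K₇]
    (he : absRamificationIdx 7 K₇ = 5) {q : K₇} (hq : q ≠ 0) (hqm : ‖q‖ = (7 : ℝ) ^ (-((1 : ℝ) / 5))) :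
    q ∈ q ^ (2 ^ 2) • logShell (PadicLogOnUnits.ofUnitLog 7 K₇) := by
  have hqm' : ‖q‖ = ((7 : ℕ) : ℝ) ^ (-(((1 : ℕ) : ℝ) / (absRamificationIdx 7 K₇ : ℝ))) := by rw [he, hqm]; norm_num
  rw [tameCell_iff_heightBed 7 K₇ (by norm_num) (by rw [he]) hq Nat.one_pos hqm', he]
  exact heightBed_x75_pos

end HeightBed

end Summit.ABC.IUTFork.Repair.RHI06StarConcreteRows

end
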